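import Literature.AlgebraicGeometry.HodgeTheory.AlgebraicClassesCup
import HarnessLib

/-!
# Classes supported on a subset: `Hⁱ_Z := ker (Hⁱ(X(ℂ); ℂ) → Hⁱ((X ∖ Z)(ℂ); ℂ))`

Family `hodge`, layer `Literature/AlgebraicGeometry/HodgeTheory`. Consumer: the special-cycle
classes of ball quotients (`Literature/AlgebraicGeometry/ShimuraVarieties/SpecialCycleClasses`,
route `HodgeConjecture/EndoscopicBallQuotient`), which are spans of classes supported on given
closed subvarieties; and every statement of the form "the class is supported on `Z`".

For a complex scheme `X` and ANY subset `Z ⊆ X` of its underlying space, the tree already has the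
restriction map `complexBetti.restrictCompl X Z i : Hⁱ(X(ℂ); ℂ) ⟶ Hⁱ((X ∖ Z)(ℂ); ℂ)` to the complex
points `{P ∈ X(ℂ) | pt P ∉ Z}` lying over the complement (`HodgeTheory/AlgebraicClasses`). This file
NAMES its kernel,

* `classesSupportedOn X Z i := ker (complexBetti.restrictCompl X Z i)` — the classes **supported
  on `Z`**, i.e. vanishing on `(X ∖ Z)(ℂ)`; by the long exact sequence of the pair this is the image
  of `Hⁱ_Z(X(ℂ)) = Hⁱ(X(ℂ), (X ∖ Z)(ℂ))` in `Hⁱ(X(ℂ))` (Grothendieck 1969, §1; Fulton 1998, §19.1),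

so that the tree's `supportedClasses X i r = Nʳ Hⁱ` is literally `⨆` of `classesSupportedOn X Z i`
over Zariski-closed `Z` of codimension `≥ r` (`supportedClasses_eq_iSup_classesSupportedOn`, `rfl`),
and proves the small API every consumer needs:

* `classesSupportedOn_mono` — `Z ⊆ Z' ⇒ Hⁱ_Z ≤ Hⁱ_{Z'}` (restriction to the smaller open set
  `(X ∖ Z')(ℂ) ⊆ (X ∖ Z)(ℂ)` factors through restriction to the larger one; functoriality of `Hⁱ`);
* `classesSupportedOn_univ`, `classesSupportedOn_empty` — everything is supported on `Z = X`
  (`(X ∖ X)(ℂ) = ∅`), nothing but `0` is supported on `∅` (`(X ∖ ∅)(ℂ) ≃ₜ X(ℂ)`);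
* `classesSupportedOn_le_supportedClasses`, `iSup_classesSupportedOn_le_algebraicClasses` — a class
  supported on a Zariski-closed `Z` all of whose points have codimension `≥ r` lies in `Nʳ Hⁱ`; in
  particular a span of classes supported on closed subsets of codimension `≥ k` in degree `2k` lies in
  `algebraicClasses X k` (for `Z` irreducible of codimension exactly `k` on `X` smooth projective,
  `H²ᵏ_Z = ℂ · cl(Z)` by `H²ᵏ(X, X ∖ Z) ≅ H^{BM}_{2n-2k}(Z(ℂ)) = ℂ · [Z]`, Fulton 1998 Lemma 19.1.1, as
  explained in the module docstring of `HodgeTheory/AlgebraicClasses`);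
* `cupProduct_mem_classesSupportedOn_inter` — `Hᵖ_Z ∪ H^q_W ⊆ H^{p+q}_{Z ∩ W}` for Zariski-closed
  `Z, W` (the tree's `restrictCompl_cupProduct_eq_zero`, Fulton 1998 §19.2).

Nothing here is new mathematics: it is a naming layer over `complexBetti.restrictCompl` so that
"supported on `Z`" can be said in one word, with `Z` allowed to be non-closed (then `(X ∖ Z)(ℂ)` is
just a subspace of `X(ℂ)`, and `classesSupportedOn_mono` reduces to the Zariski closure when needed).

## References

* A. Grothendieck, *Hodge's general conjecture is false for trivial reasons*, Topology 8 (1969), §1.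
* W. Fulton, *Intersection Theory*, 2nd ed. (1998), §19.1 (eq. (1), Lemma 19.1.1), §19.2.
-/

noncomputable section

open CategoryTheory AlgebraicGeometry

namespace Literature.AlgebraicGeometry.HodgeTheory

section HodgeTheory

open Literature.AlgebraicTopology.SingularHomology

variable (X : Motives.SchemeOver ℂ)

/-- The classes in `Hⁱ(X(ℂ); ℂ)` **supported on** a subset `Z ⊆ X`: the kernel of the restriction
`Hⁱ(X(ℂ); ℂ) → Hⁱ((X ∖ Z)(ℂ); ℂ)` to the complex points over the complement of `Z`; equivalently (long
exact sequence of the pair) the image of `Hⁱ_Z(X(ℂ); ℂ) = Hⁱ(X(ℂ), (X ∖ Z)(ℂ); ℂ) → Hⁱ(X(ℂ); ℂ)`.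
For `Z` Zariski-closed these are the generators of Grothendieck's coniveau filtration.
[cite: GrothendieckTopology1969, §1] -/
def classesSupportedOn (Z : Set X.left) (i : ℕ) : Submodule ℂ (complexBetti X i) :=
  LinearMap.ker (complexBetti.restrictCompl X Z i).hom

variable {X}

/-- Unfolding: `x` is supported on `Z` iff its restriction to `(X ∖ Z)(ℂ)` vanishes.
[cite: GrothendieckTopology1969, §1] -/
@[simp]
theorem mem_classesSupportedOn_iff {Z : Set X.left} {i : ℕ} {x : complexBetti X i} :
    x ∈ classesSupportedOn X Z i ↔ complexBetti.restrictCompl X Z i x = 0 :=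
  LinearMap.mem_ker

variable (X) in
/-- The tree's `Nʳ Hⁱ(X(ℂ); ℂ) = supportedClasses X i r` is the span of the `classesSupportedOn X Z i`
over Zariski-closed `Z` of codimension `≥ r` (definitional unfolding). [cite: GrothendieckTopology1969, §1] -/
theorem supportedClasses_eq_iSup_classesSupportedOn (i r : ℕ) :
    supportedClasses X i r =
      ⨆ (Z : Set X.left) (_ : IsClosed Z) (_ : ∀ z ∈ Z, (r : ℕ∞) ≤ Order.coheight z),
        classesSupportedOn X Z i :=
  rfl

/-- A class supported on a Zariski-closed `Z` all of whose points have codimension `≥ r` lies in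
`Nʳ Hⁱ(X(ℂ); ℂ)`. [cite: GrothendieckTopology1969, §1] -/
theorem classesSupportedOn_le_supportedClasses {Z : Set X.left} (hZ : IsClosed Z) {r : ℕ}
    (hr : ∀ z ∈ Z, (r : ℕ∞) ≤ Order.coheight z) (i : ℕ) :
    classesSupportedOn X Z i ≤ supportedClasses X i r :=
  fun _ hx ↦ mem_supportedClasses_of_restrictCompl_eq_zero hZ hr (mem_classesSupportedOn_iff.mp hx)

/-- A span of classes supported on Zariski-closed subsets `Z j` of codimension `≥ k`, in degree
`2k`, consists of algebraic classes: `⨆ⱼ H²ᵏ_{Z j} ≤ Nᵏ H²ᵏ = algebraicClasses X k` (for `Z j`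
irreducible of codimension `k`, `H²ᵏ_{Z j} = ℂ · cl(Z j)`, Fulton 1998, Lemma 19.1.1).
[cite: Fulton1998, §19.1 Lemma 19.1.1] -/
theorem iSup_classesSupportedOn_le_algebraicClasses {ι : Sort*} {Z : ι → Set X.left} {k : ℕ}
    (hZ : ∀ j, IsClosed (Z j)) (hk : ∀ j, ∀ z ∈ Z j, (k : ℕ∞) ≤ Order.coheight z) :
    ⨆ j, classesSupportedOn X (Z j) (2 * k) ≤ algebraicClasses X k :=
  iSup_le fun j ↦ classesSupportedOn_le_supportedClasses (hZ j) (hk j) _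

/-- The inclusion `(X ∖ Z')(ℂ) ↪ (X ∖ Z)(ℂ)` of complex points over complements, for `Z ⊆ Z'`.
[folklore] -/
def complexPointsComplInclusion {Z Z' : Set X.left} (h : Z ⊆ Z') :
    C(Motives.complexPointsCompl X Z', Motives.complexPointsCompl X Z) :=
  ⟨fun P ↦ ⟨P.1, fun hP ↦ P.2 (h hP)⟩, by fun_prop⟩

/-- Restriction to the smaller open set `(X ∖ Z')(ℂ)` factors through restriction to `(X ∖ Z)(ℂ)`
for `Z ⊆ Z'` (contravariant functoriality of `Hⁱ`, Hatcher §3.1). [folklore] -/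
theorem restrictCompl_eq_comp {Z Z' : Set X.left} (h : Z ⊆ Z') (i : ℕ) :
    complexBetti.restrictCompl X Z' i =
      complexBetti.restrictCompl X Z i ≫
        singularCohomology.map ℂ ℂ (complexPointsComplInclusion h) i := by
  rw [complexBetti.restrictCompl, complexBetti.restrictCompl, ← singularCohomology.map_comp]
  rfl

/-- **Monotonicity in the support**: `Z ⊆ Z' ⇒ Hⁱ_Z ≤ Hⁱ_{Z'}` (a class vanishing on `(X ∖ Z)(ℂ)`
vanishes on the smaller `(X ∖ Z')(ℂ)`). [cite: GrothendieckTopology1969, §1] -/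
theorem classesSupportedOn_mono {Z Z' : Set X.left} (h : Z ⊆ Z') (i : ℕ) :
    classesSupportedOn X Z i ≤ classesSupportedOn X Z' i := by
  intro x hx
  rw [mem_classesSupportedOn_iff] at hx ⊢
  rw [restrictCompl_eq_comp h i, ModuleCat.comp_apply, hx, map_zero]

variable (X) in
/-- Every class is supported on `Z = X`: `(X ∖ X)(ℂ)` is empty, so its cohomology vanishes.
[cite: GrothendieckTopology1969, §1] -/
theorem classesSupportedOn_univ (i : ℕ) : classesSupportedOn X Set.univ i = ⊤ := by
  refine eq_top_iff.2 fun x _ ↦ mem_classesSupportedOn_iff.mpr ?_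
  haveI : IsEmpty (Motives.complexPointsCompl X Set.univ) := ⟨fun P ↦ P.2 (Set.mem_univ _)⟩
  haveI := ModuleCat.subsingleton_of_isZero
    (Motives.isZero_singularCohomology_of_isEmpty ℂ ℂ (E := Motives.complexPointsCompl X Set.univ) i)
  exact Subsingleton.elim _ _

variable (X) in
/-- The complex points over the complement of `∅` are all of `X(ℂ)`: the tautological homeomorphism
`(X ∖ ∅)(ℂ) ≃ₜ X(ℂ)`. [folklore] -/
def complexPointsComplEmptyHomeomorph : Motives.complexPointsCompl X ∅ ≃ₜ Motives.ComplexPoints X where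
  toEquiv := Equiv.subtypeUnivEquiv fun P ↦ Set.notMem_empty _
  continuous_toFun := continuous_subtype_val
  continuous_invFun := by
    change Continuous fun P : Motives.ComplexPoints X ↦ (⟨P, Set.notMem_empty _⟩ : Motives.complexPointsCompl X ∅)
    fun_prop

variable (X) in
/-- **No nonzero class is supported on `∅`**: restriction to `(X ∖ ∅)(ℂ) = X(ℂ)` is an isomorphism
(sanity check that `classesSupportedOn` is not trivially large). [cite: GrothendieckTopology1969, §1] -/
theorem classesSupportedOn_empty (i : ℕ) : classesSupportedOn X ∅ i = ⊥ := by
  refine eq_bot_iff.2 fun x hx ↦ ?_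
  rw [mem_classesSupportedOn_iff] at hx
  have hiso : complexBetti.restrictCompl X ∅ i =
      (singularCohomology.mapIso ℂ ℂ (complexPointsComplEmptyHomeomorph X) i).hom := rfl
  rw [hiso] at hx
  have h := CategoryTheory.Iso.hom_inv_id_apply
    (singularCohomology.mapIso ℂ ℂ (complexPointsComplEmptyHomeomorph X) i) x
  rw [hx, map_zero] at h
  exact (Submodule.mem_bot ℂ).2 h.symm

/-- `supportedClasses X i r` is the span of the classes supported on closed subsets of codimension
`≥ r`: each generator is a `classesSupportedOn`. [cite: GrothendieckTopology1969, §1] -/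
theorem classesSupportedOn_le_supportedClasses_iff {i r : ℕ} {S : Submodule ℂ (complexBetti X i)} :
    supportedClasses X i r ≤ S ↔
      ∀ ⦃Z : Set X.left⦄, IsClosed Z → (∀ z ∈ Z, (r : ℕ∞) ≤ Order.coheight z) →
        classesSupportedOn X Z i ≤ S := by
  simp only [supportedClasses_eq_iSup_classesSupportedOn, iSup_le_iff]

/-- **Cup product with supports**: for Zariski-closed `Z, W ⊆ X`, `Hᵖ_Z ∪ H^q_W ⊆ H^{p+q}_{Z ∩ W}`
(Fulton 1998, §19.2; the tree's `restrictCompl_cupProduct_eq_zero`). [cite: Fulton1998, §19.2 Cor. 19.2] -/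
theorem cupProduct_mem_classesSupportedOn_inter {Z W : Set X.left} (hZ : IsClosed Z)
    (hW : IsClosed W) {p q m : ℕ} (hpq : p + q = m) {a : complexBetti X p} {b : complexBetti X q}
    (ha : a ∈ classesSupportedOn X Z p) (hb : b ∈ classesSupportedOn X W q) :
    cupProduct hpq a b ∈ classesSupportedOn X (Z ∩ W) m :=
  mem_classesSupportedOn_iff.mpr
    (restrictCompl_cupProduct_eq_zero hZ hW hpq (mem_classesSupportedOn_iff.mp ha)
      (mem_classesSupportedOn_iff.mp hb))

end HodgeTheory

end Literature.AlgebraicGeometry.HodgeTheory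

end
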